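/-
Copyright (c) 2026. All rights reserved.
Released under Apache 2.0 license as described in the file LICENSE.
-/
import Literature.AlgebraicGeometry.ComplexMultiplication.HyperellipticJacobianLevelTwelve
import HarnessLib

/-!
# `J_{12} ∼ X_3² × X_4³`: the Jacobian of `y² = x^{12} + 1` through its CM data —
# `End⁰(J_{12}) ≅ Mat₂(ℚ(ζ_3)) × Mat₃(ℚ(ζ_4))`, of dimension `26`, `dim J_{12} = 5`

Layer `Literature/AlgebraicGeometry/ComplexMultiplication`, namespace `…ComplexMultiplication.HyperellipticJacobian`; the sequel of
`HyperellipticJacobianLevelTwelve` (F14: `X_{12} ∼ X_4 × X_4`), `HyperellipticJacobianCrossLevelOrthogonality` (F12: `X_3, X_6 ⟂ X_4, X_{12}`),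
`HyperellipticJacobianTwiceOddLevel` (F7: `X_6 ∼ X_3`), `HyperellipticJacobianTwiceOddJacobian` (F11: `A ⊕ A′ ∼ A²`, `Mat_m(End⁰ B) ≅ End⁰(B^m)`)
and `HyperellipticJacobianEndomorphismAlgebras` (F9: `End⁰(X_3) = ℚ(ζ_3)`).  THEOREMS ONLY (no definition, no named fact, no `sorry`, no
instance).

## The print and the point

A. Gallese, H. Goodson, D. Lombardo, arXiv:2405.20394 [GalleseGoodsonLombardo2024] §3 THM. 3.0 (held `paper:arxiv-2405.20394` p0012): «`J_m ∼
∏_{d ∣ m, d ≠ 1,2} X_d`», (4) «`X_6 ∼ X_3`», (5) «`X_{12} ∼ Y_{12}²`», and «all `X_d` with odd `d` and all `Y_d` are pairwise non-isogenous»;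
§3.5 after LEMMA 14: «this lemma, combined with the last statement in Thm. 3.0, yields the geometric endomorphism algebra of `J_m` for every
`m`».  For `m = 12` the divisors are `3, 4, 6, 12`; since `Y_{12} ∼ X_4` (F14) the recipe must be applied with the factor list
`{X_3 (×2), X_4 (×3)}`: **`J_{12} ∼ X_3² × X_4³`**, **`End⁰(J_{12}) ≅ Mat₂(ℚ(ζ_3)) × Mat₃(ℚ(i))`** of dimension `8 + 18 = 26` (reading `X_4` and
`Y_{12}` as non-isogenous would give `Mat₂(ℚ(ζ_3)) × ℚ(i) × Mat₂(ℚ(i))`, of dimension `18`); `dim J_{12} = 5 = g(C_{12})`.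

## The carrier

`K₃ = ℚ(ζ_3)`, `Φ₃`, `A₃` (`X_3`); `L = ℚ(ζ_6)` (an `IsCyclotomicExtension {2 * 3}`), `Ψ`, `A₆` (`X_6`); `K₄ = ℚ(ζ_4)`, `Φ₄`, `A₄` (`X_4`);
`K₁₂ = ℚ(ζ_{12})`, `Φ₁₂`, `A₁₂` (`X_{12}`); all types lower halves.  `J_{12}` is read as `⨁_{Fin 2} ![⨁_{Fin 2} ![A₃, A₆], ⨁_{Fin 2} ![A₄, A₁₂]]`
(the `ℚ(ζ_3)`-block and the `ℚ(i)`-block).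

## What is proved

`isIsogenous_pair_biproduct_three` (bookkeeping: `X ⊕ (X ⊕ X) ∼ ⨁_{Fin 3} X`), **`isIsogenous_four_twelve_biproduct_three`**
(`A₄ ⊕ A₁₂ ∼ ⨁_{Fin 3} A₄`), `nonempty_endAlgebra_four_twelve_algEquiv_matrix` (`End⁰(A₄ ⊕ A₁₂) ≃ₐ[ℚ] Mat₃(ℚ(ζ_4))`),
`nonempty_endAlgebra_three_six_algEquiv_matrix` (`End⁰(A₃ ⊕ A₆) ≃ₐ[ℚ] Mat₂(ℚ(ζ_3))`), `hom_eq_zero_blocks_twelve` (the two blocks are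
orthogonal), **`nonempty_endAlgebra_algEquiv_twelveJacobian`** (`End⁰(J) ≃ₐ[ℚ] Mat₂(ℚ(ζ_3)) × Mat₃(ℚ(ζ_4))`),
**`finrank_endAlgebra_twelveJacobian`** (`dim_ℚ End⁰(J) = 26`, `dim J = 5`).

## Honest column ∕ NOT here

The curve `y² = x^{12} + 1` and the identification of the biproduct with `J_{12}`; the flat form `⨁ ![A₃, A₆, A₄, A₁₂]` (a re-indexing
away).  `HC_CM` is not touched.

## References

* [GalleseGoodsonLombardo2024] A. Gallese, H. Goodson, D. Lombardo, arXiv:2405.20394 — §3 Thm. 3.0 ((4), (5), last statement), §3.5 Lemma 14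
  and the sentence following it.
* [MumfordAV1970] D. Mumford, *Abelian Varieties* — §19 Thm. 3 Cor. 1–2, p. 174.
* [Shimura1998] G. Shimura — §5.1 Prop. 3 (proof), Prop. 6.
* [MilneCM2006] J. S. Milne — Ch. I §3 Prop. 3.13.

## Provenance

Cell `pub-hodgecm2` (COR-CM), KEPT Literature lane `lit-deligne-3` gen 51 (claim GGL24-LEVEL-TWELVE-JACOBIAN; count-neutral, own lane).
-/

noncomputable section

open CategoryTheory CategoryTheory.Limits NumberField Module

namespace Literature.AlgebraicGeometry.ComplexMultiplication

open Literature.AlgebraicGeometry.Motives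
open Literature.AlgebraicGeometry.HodgeTheory (complexBetti)
open Literature.NumberTheory.ComplexMultiplication
open Literature.AlgebraicGeometry.Milne1999 (isIsogeny_biproduct_map)

namespace HyperellipticJacobian

open Literature.AlgebraicGeometry.Pohlmann1968 Literature.AlgebraicGeometry.Pohlmann1968.Cyclotomic

/-! ## §1 Bookkeeping: `X ⊕ (X ⊕ X) ≅ ⨁_{Fin 3} X`, and the product of two algebras indexed by `Fin 2` -/

section Plumbing

/-- **`X ⊕ (X ⊕ X) ∼ ⨁_{Fin 3} X`** (an isomorphism of biproducts, re-indexing `Fin 1 ⊔ Fin 2 = Fin 3`; recorded as an isogeny).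
[cite: MumfordAV1970, §19 (p. 174)] -/
theorem isIsogenous_pair_biproduct_three (X : AbelianVariety ℂ) :
    AbelianVariety.IsIsogenous (⨁ fun j : Fin 2 => (![X, ⨁ fun _ : Fin 2 => X] : Fin 2 → AbelianVariety ℂ) j)
      (⨁ fun _ : Fin 3 => X) := by
  classical
  let F : Fin 2 → AbelianVariety ℂ := fun j => (![X, ⨁ fun _ : Fin 2 => X] : Fin 2 → AbelianVariety ℂ) j
  -- the identifications `F 0 = X`, `F 1 = X ⊕ X` as morphisms (so that all compositions below are syntactically typed)
  let c₀ : F 0 ⟶ X := eqToHom rfl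
  let d₀ : X ⟶ F 0 := eqToHom rfl
  let c : F 1 ⟶ ⨁ fun _ : Fin 2 => X := eqToHom rfl
  let d : (⨁ fun _ : Fin 2 => X) ⟶ F 1 := eqToHom rfl
  have hdc₀ : d₀ ≫ c₀ = 𝟙 X := by simp only [c₀, d₀, eqToHom_trans, eqToHom_refl]
  have hdc : d ≫ c = 𝟙 _ := by simp only [c, d, eqToHom_trans, eqToHom_refl]
  have hcd₀ : ∀ {Z : AbelianVariety ℂ} (h : F 0 ⟶ Z), c₀ ≫ d₀ ≫ h = h := fun h => by
    simp only [c₀, d₀, eqToHom_trans_assoc, eqToHom_refl, Category.id_comp]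
  have hcd : ∀ {Z : AbelianVariety ℂ} (h : F 1 ⟶ Z), c ≫ d ≫ h = h := fun h => by
    simp only [c, d, eqToHom_trans_assoc, eqToHom_refl, Category.id_comp]
  have hdc' : ∀ {Z : AbelianVariety ℂ} (h : (⨁ fun _ : Fin 2 => X) ⟶ Z), d ≫ c ≫ h = h := fun h => by
    rw [← Category.assoc, hdc, Category.id_comp]
  -- coordinate projections and inclusions
  let p : ∀ k : Fin 3, (⨁ F) ⟶ (fun _ : Fin 3 => X) k := fun k => match k with
    | ⟨0, _⟩ => biproduct.π F 0 ≫ c₀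
    | ⟨1, _⟩ => biproduct.π F 1 ≫ c ≫ biproduct.π (fun _ : Fin 2 => X) 0
    | ⟨2, _⟩ => biproduct.π F 1 ≫ c ≫ biproduct.π (fun _ : Fin 2 => X) 1
  let q : ∀ k : Fin 3, (fun _ : Fin 3 => X) k ⟶ ⨁ F := fun k => match k with
    | ⟨0, _⟩ => d₀ ≫ biproduct.ι F 0
    | ⟨1, _⟩ => biproduct.ι (fun _ : Fin 2 => X) 0 ≫ d ≫ biproduct.ι F 1
    | ⟨2, _⟩ => biproduct.ι (fun _ : Fin 2 => X) 1 ≫ d ≫ biproduct.ι F 1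
  have h01 : (0 : Fin 2) ≠ 1 := by decide
  have h10 : (1 : Fin 2) ≠ 0 := by decide
  have hqp : ∀ k l : Fin 3, q k ≫ p l = biproduct.ι (fun _ : Fin 3 => X) k ≫ biproduct.π (fun _ : Fin 3 => X) l := by
    intro k l
    match k, l with
    | ⟨0, _⟩, ⟨0, _⟩ =>
      show (d₀ ≫ biproduct.ι F 0) ≫ (biproduct.π F 0 ≫ c₀) = _
      simp only [Category.assoc, biproduct.ι_π_self_assoc, hdc₀, biproduct.ι_π_self]
    | ⟨0, _⟩, ⟨1, _⟩ =>
      show (d₀ ≫ biproduct.ι F 0) ≫ (biproduct.π F 1 ≫ c ≫ biproduct.π (fun _ : Fin 2 => X) 0) = _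
      simp only [Category.assoc, biproduct.ι_π_ne_assoc F h01, zero_comp, comp_zero]
      exact (biproduct.ι_π_ne (fun _ : Fin 3 => X) (Fin.ne_of_val_ne (by norm_num))).symm
    | ⟨0, _⟩, ⟨2, _⟩ =>
      show (d₀ ≫ biproduct.ι F 0) ≫ (biproduct.π F 1 ≫ c ≫ biproduct.π (fun _ : Fin 2 => X) 1) = _
      simp only [Category.assoc, biproduct.ι_π_ne_assoc F h01, zero_comp, comp_zero]
      exact (biproduct.ι_π_ne (fun _ : Fin 3 => X) (Fin.ne_of_val_ne (by norm_num))).symm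
    | ⟨1, _⟩, ⟨0, _⟩ =>
      show (biproduct.ι (fun _ : Fin 2 => X) 0 ≫ d ≫ biproduct.ι F 1) ≫ (biproduct.π F 0 ≫ c₀) = _
      simp only [Category.assoc, biproduct.ι_π_ne_assoc F h10, zero_comp, comp_zero]
      exact (biproduct.ι_π_ne (fun _ : Fin 3 => X) (Fin.ne_of_val_ne (by norm_num))).symm
    | ⟨1, _⟩, ⟨1, _⟩ =>
      show (biproduct.ι (fun _ : Fin 2 => X) 0 ≫ d ≫ biproduct.ι F 1) ≫
          (biproduct.π F 1 ≫ c ≫ biproduct.π (fun _ : Fin 2 => X) 0) = _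
      simp only [Category.assoc, biproduct.ι_π_self_assoc, hdc', biproduct.ι_π_self]
    | ⟨1, _⟩, ⟨2, _⟩ =>
      show (biproduct.ι (fun _ : Fin 2 => X) 0 ≫ d ≫ biproduct.ι F 1) ≫
          (biproduct.π F 1 ≫ c ≫ biproduct.π (fun _ : Fin 2 => X) 1) = _
      simp only [Category.assoc, biproduct.ι_π_self_assoc, hdc', biproduct.ι_π_ne (fun _ : Fin 2 => X) h01]
      exact (biproduct.ι_π_ne (fun _ : Fin 3 => X) (Fin.ne_of_val_ne (by norm_num))).symm
    | ⟨2, _⟩, ⟨0, _⟩ =>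
      show (biproduct.ι (fun _ : Fin 2 => X) 1 ≫ d ≫ biproduct.ι F 1) ≫ (biproduct.π F 0 ≫ c₀) = _
      simp only [Category.assoc, biproduct.ι_π_ne_assoc F h10, zero_comp, comp_zero]
      exact (biproduct.ι_π_ne (fun _ : Fin 3 => X) (Fin.ne_of_val_ne (by norm_num))).symm
    | ⟨2, _⟩, ⟨1, _⟩ =>
      show (biproduct.ι (fun _ : Fin 2 => X) 1 ≫ d ≫ biproduct.ι F 1) ≫
          (biproduct.π F 1 ≫ c ≫ biproduct.π (fun _ : Fin 2 => X) 0) = _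
      simp only [Category.assoc, biproduct.ι_π_self_assoc, hdc', biproduct.ι_π_ne (fun _ : Fin 2 => X) h10]
      exact (biproduct.ι_π_ne (fun _ : Fin 3 => X) (Fin.ne_of_val_ne (by norm_num))).symm
    | ⟨2, _⟩, ⟨2, _⟩ =>
      show (biproduct.ι (fun _ : Fin 2 => X) 1 ≫ d ≫ biproduct.ι F 1) ≫
          (biproduct.π F 1 ≫ c ≫ biproduct.π (fun _ : Fin 2 => X) 1) = _
      simp only [Category.assoc, biproduct.ι_π_self_assoc, hdc', biproduct.ι_π_self]
  have h2 : biproduct.π (fun _ : Fin 2 => X) 0 ≫ biproduct.ι (fun _ : Fin 2 => X) 0 +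
      biproduct.π (fun _ : Fin 2 => X) 1 ≫ biproduct.ι (fun _ : Fin 2 => X) 1 = 𝟙 _ := by
    have h := biproduct.total (f := fun _ : Fin 2 => X)
    rwa [Fin.sum_univ_two] at h
  have hF : biproduct.π F 0 ≫ biproduct.ι F 0 + biproduct.π F 1 ≫ biproduct.ι F 1 = 𝟙 (⨁ F) := by
    have h := biproduct.total (f := F)
    rwa [Fin.sum_univ_two] at h
  have hpq : ∑ k, p k ≫ q k = 𝟙 (⨁ F) := by
    rw [Fin.sum_univ_three]
    show (biproduct.π F 0 ≫ c₀) ≫ (d₀ ≫ biproduct.ι F 0) +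
        (biproduct.π F 1 ≫ c ≫ biproduct.π (fun _ : Fin 2 => X) 0) ≫ (biproduct.ι (fun _ : Fin 2 => X) 0 ≫ d ≫ biproduct.ι F 1) +
        (biproduct.π F 1 ≫ c ≫ biproduct.π (fun _ : Fin 2 => X) 1) ≫ (biproduct.ι (fun _ : Fin 2 => X) 1 ≫ d ≫ biproduct.ι F 1) =
        𝟙 (⨁ F)
    have hstep : (biproduct.π F 1 ≫ c ≫ biproduct.π (fun _ : Fin 2 => X) 0) ≫
          (biproduct.ι (fun _ : Fin 2 => X) 0 ≫ d ≫ biproduct.ι F 1) +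
        (biproduct.π F 1 ≫ c ≫ biproduct.π (fun _ : Fin 2 => X) 1) ≫ (biproduct.ι (fun _ : Fin 2 => X) 1 ≫ d ≫ biproduct.ι F 1) =
        biproduct.π F 1 ≫ c ≫ (biproduct.π (fun _ : Fin 2 => X) 0 ≫ biproduct.ι (fun _ : Fin 2 => X) 0 +
          biproduct.π (fun _ : Fin 2 => X) 1 ≫ biproduct.ι (fun _ : Fin 2 => X) 1) ≫ d ≫ biproduct.ι F 1 := by
      simp only [Preadditive.comp_add, Preadditive.add_comp, Category.assoc]
    rw [add_assoc, hstep, h2, Category.id_comp, hcd, Category.assoc, hcd₀, hF]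
  let e : (⨁ F) ≅ ⨁ fun _ : Fin 3 => X :=
    { hom := biproduct.lift p
      inv := biproduct.desc q
      hom_inv_id := by rw [biproduct.lift_desc, hpq]
      inv_hom_id := by
        refine biproduct.hom_ext _ _ fun l => biproduct.hom_ext' _ _ fun k => ?_
        rw [Category.assoc, biproduct.lift_π, biproduct.ι_desc_assoc, Category.id_comp, hqp] }
  exact ⟨e.hom, @HodgeTheory.AbelianVariety.isIsogeny_of_isIso _ _ e.hom (Iso.isIso_hom e)⟩

/-- The product of two algebras indexed by `Fin 2` (`∏_{i : Fin 2} T_i ≃ₐ T₀ × T₁`). [folklore] -/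
private theorem nonempty_pi_fin_two_algEquiv_prod (T : Fin 2 → Type) [∀ i, Ring (T i)] [∀ i, Algebra ℚ (T i)] :
    Nonempty ((∀ i, T i) ≃ₐ[ℚ] T 0 × T 1) := by
  refine ⟨AlgEquiv.ofBijective ((Pi.evalAlgHom ℚ T 0).prod (Pi.evalAlgHom ℚ T 1)) ⟨fun f g h => ?_, fun x => ?_⟩⟩
  · simp only [AlgHom.prod_apply, Pi.evalAlgHom_apply, Prod.mk.injEq] at h
    funext i
    match i with
    | ⟨0, _⟩ => exact h.1
    | ⟨1, _⟩ => exact h.2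
  · exact ⟨Fin.cons x.1 (Fin.cons x.2 finZeroElim), rfl⟩

end Plumbing

/-! ## §2 The `ℚ(i)`-block `A₄ ⊕ A₁₂ ∼ ⨁_{Fin 3} A₄` and the `ℚ(ζ_3)`-block `A₃ ⊕ A₆ ∼ A₃²` -/

section Blocks

variable {K₄ : Type} [Field K₄] [NumberField K₄] [IsCyclotomicExtension {4} ℚ K₄] {Φ₄ : CMType K₄}
  {A₄ : AbelianVariety ℂ} {ι₄ : 𝓞 K₄ →+* End A₄} {θ₄ : K₄ →+* Module.End ℂ (complexBetti A₄.X 1)}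
  {K₁₂ : Type} [Field K₁₂] [NumberField K₁₂] [IsCyclotomicExtension {12} ℚ K₁₂] {Φ₁₂ : CMType K₁₂}
  {A₁₂ : AbelianVariety ℂ} {ι₁₂ : 𝓞 K₁₂ →+* End A₁₂} {θ₁₂ : K₁₂ →+* Module.End ℂ (complexBetti A₁₂.X 1)}
  {K₃ : Type} [Field K₃] [NumberField K₃] [IsCyclotomicExtension {3} ℚ K₃] {Φ₃ : CMType K₃}
  {A₃ : AbelianVariety ℂ} {ι₃ : 𝓞 K₃ →+* End A₃} {θ₃ : K₃ →+* Module.End ℂ (complexBetti A₃.X 1)}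
  {L : Type} [Field L] [NumberField L] [IsCyclotomicExtension {2 * 3} ℚ L] {Ψ : CMType L}
  {A₆ : AbelianVariety ℂ} {ι₆ : 𝓞 L →+* End A₆} {θ₆ : L →+* Module.End ℂ (complexBetti A₆.X 1)}

/-- **`X_4 ⊕ X_{12} ∼ X_4³`**: for realisations `A₄` of `Φ_4` and `A₁₂` of `Φ_{12}`, `A₄ ⊕ A₁₂ ∼ ⨁_{Fin 3} A₄` (`A₁₂ ∼ A₄ ⊕ A₄`, F14, then
re-indexing). [cite: GalleseGoodsonLombardo2024, §3 Thm. 3.0 (5)] [cite: MumfordAV1970, §19 (p. 174)] -/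
theorem isIsogenous_four_twelve_biproduct_three (hΦ₄ : ∀ σ : K₄ →+* ℂ, σ ∈ Φ₄.1 ↔ 2 * (expOf 4 K₄ σ).val < 4)
    (hA₄ : IsCMTypeRealisation Φ₄ A₄ ι₄ θ₄)
    (hΦ₁₂ : ∀ σ : K₁₂ →+* ℂ, σ ∈ Φ₁₂.1 ↔ 2 * (expOf 12 K₁₂ σ).val < 12) (hA₁₂ : IsCMTypeRealisation Φ₁₂ A₁₂ ι₁₂ θ₁₂) :
    AbelianVariety.IsIsogenous (⨁ fun j : Fin 2 => (![A₄, A₁₂] : Fin 2 → AbelianVariety ℂ) j) (⨁ fun _ : Fin 3 => A₄) := by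
  obtain ⟨u, hu⟩ := isIsogenous_twelve_biproduct_four hΦ₄ hA₄ hΦ₁₂ hA₁₂
  -- `A₄ ⊕ A₁₂ → A₄ ⊕ (A₄ ⊕ A₄)` componentwise, then the re-indexing
  let g : ∀ j : Fin 2, (![A₄, A₁₂] : Fin 2 → AbelianVariety ℂ) j ⟶
      (![A₄, ⨁ fun _ : Fin 2 => A₄] : Fin 2 → AbelianVariety ℂ) j :=
    fun j => match j with
      | ⟨0, _⟩ => 𝟙 A₄
      | ⟨1, _⟩ => u
  have hg : ∀ j, AbelianVariety.IsIsogeny (g j) := fun j => match j with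
      | ⟨0, _⟩ => AbelianVariety.isIsogeny_id A₄
      | ⟨1, _⟩ => hu
  exact (show AbelianVariety.IsIsogenous _ _ from ⟨biproduct.map g, isIsogeny_biproduct_map hg⟩).trans
    (isIsogenous_pair_biproduct_three A₄)

/-- **`End⁰(X_4 ⊕ X_{12}) ≃ₐ[ℚ] Mat₃(ℚ(ζ_4))`** (`End⁰` is an isogeny invariant; `End⁰(A₄³) = Mat₃(End⁰ A₄)`, `End⁰(A₄) = ℚ(ζ_4)`).
[cite: GalleseGoodsonLombardo2024, §3.5 Lemma 14 and the sentence following it; §3 Thm. 3.0 (5)] [cite: MumfordAV1970, §19 Cor. 2 of Thm. 3 and p. 174]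
[cite: Shimura1998, §5.1 Prop. 3 (proof) and Prop. 6] -/
theorem nonempty_endAlgebra_four_twelve_algEquiv_matrix (hΦ₄ : ∀ σ : K₄ →+* ℂ, σ ∈ Φ₄.1 ↔ 2 * (expOf 4 K₄ σ).val < 4)
    (hA₄ : IsCMTypeRealisation Φ₄ A₄ ι₄ θ₄)
    (hΦ₁₂ : ∀ σ : K₁₂ →+* ℂ, σ ∈ Φ₁₂.1 ↔ 2 * (expOf 12 K₁₂ σ).val < 12) (hA₁₂ : IsCMTypeRealisation Φ₁₂ A₁₂ ι₁₂ θ₁₂) :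
    Nonempty ((⨁ fun j : Fin 2 => (![A₄, A₁₂] : Fin 2 → AbelianVariety ℂ) j).endAlgebra ≃ₐ[ℚ] Matrix (Fin 3) (Fin 3) K₄) := by
  obtain ⟨e₁⟩ := (isIsogenous_four_twelve_biproduct_three hΦ₄ hA₄ hΦ₁₂ hA₁₂).nonempty_endAlgebra_algEquiv
  obtain ⟨e₂⟩ := nonempty_matrix_algEquiv_endAlgebra_biproduct_const A₄ 3
  obtain ⟨e₃⟩ := hA₄.nonempty_endAlgebra_algEquiv_of_isSimple (isSimple_four hA₄)
  exact ⟨(e₁.trans e₂.symm).trans e₃.mapMatrix⟩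

/-- **`End⁰(X_3 ⊕ X_6) ≃ₐ[ℚ] Mat₂(ℚ(ζ_3))`** (`X_6 ∼ X_3`, Thm. 3.0 (4); `End⁰(X_3) = ℚ(ζ_3)`, Lemma 14, first case).
[cite: GalleseGoodsonLombardo2024, §3 Thm. 3.0 (4) and §3.5 Lemma 14] [cite: MumfordAV1970, §19 Cor. 2 of Thm. 3 and p. 174]
[cite: Shimura1998, §5.1 Prop. 3 (proof) and Prop. 6] -/
theorem nonempty_endAlgebra_three_six_algEquiv_matrix (hΦ₃ : ∀ σ : K₃ →+* ℂ, σ ∈ Φ₃.1 ↔ 2 * (expOf 3 K₃ σ).val < 3)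
    (hA₃ : IsCMTypeRealisation Φ₃ A₃ ι₃ θ₃)
    (hΨ : ∀ σ : L →+* ℂ, σ ∈ Ψ.1 ↔ 2 * (expOf (2 * 3) L σ).val < 2 * 3) (hA₆ : IsCMTypeRealisation Ψ A₆ ι₆ θ₆) :
    Nonempty ((⨁ fun j : Fin 2 => (![A₃, A₆] : Fin 2 → AbelianVariety ℂ) j).endAlgebra ≃ₐ[ℚ] Matrix (Fin 2) (Fin 2) K₃) := by
  haveI : NeZero (3 : ℕ) := ⟨by norm_num⟩
  haveI : NeZero (2 * 3 : ℕ) := ⟨by norm_num⟩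
  have hodd : Odd 3 := by decide
  obtain ⟨f₁⟩ := (isIsogenous_biproduct_pair (isIsogenous_twiceOdd hodd le_rfl hΨ hΦ₃ hA₆ hA₃)).nonempty_endAlgebra_algEquiv
  obtain ⟨f₂⟩ := nonempty_matrix_algEquiv_endAlgebra_biproduct_const A₃ 2
  obtain ⟨f₃⟩ := nonempty_endAlgebra_algEquiv_odd hodd Φ₃ hΦ₃ hA₃
  exact ⟨(f₁.trans f₂.symm).trans f₃.mapMatrix⟩

/-- **The `ℚ(ζ_3)`-block and the `ℚ(i)`-block of `J_{12}` are orthogonal**: every homomorphism between `A₃ ⊕ A₆` and `A₄ ⊕ A₁₂` (either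
way) vanishes (F12: `X_3, X_6 ⟂ X_4` by the cube roots of unity in `ℚ(ζ_3) = K*`, `X_3, X_6 ⟂ X_{12}` likewise; componentwise).
[cite: GalleseGoodsonLombardo2024, §3 Thm. 3.0 (last statement)] [cite: MilneCM2006, Ch. I §3 Prop. 3.13] -/
theorem hom_eq_zero_blocks_twelve (hΦ₃ : ∀ σ : K₃ →+* ℂ, σ ∈ Φ₃.1 ↔ 2 * (expOf 3 K₃ σ).val < 3)
    (hA₃ : IsCMTypeRealisation Φ₃ A₃ ι₃ θ₃)
    (hΨ : ∀ σ : L →+* ℂ, σ ∈ Ψ.1 ↔ 2 * (expOf (2 * 3) L σ).val < 2 * 3) (hA₆ : IsCMTypeRealisation Ψ A₆ ι₆ θ₆)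
    (hA₄ : IsCMTypeRealisation Φ₄ A₄ ι₄ θ₄)
    (hΦ₁₂ : ∀ σ : K₁₂ →+* ℂ, σ ∈ Φ₁₂.1 ↔ 2 * (expOf 12 K₁₂ σ).val < 12) (hA₁₂ : IsCMTypeRealisation Φ₁₂ A₁₂ ι₁₂ θ₁₂) :
    ∀ i j : Fin 2, i ≠ j →
      ∀ f : (![⨁ fun j : Fin 2 => (![A₃, A₆] : Fin 2 → AbelianVariety ℂ) j,
              ⨁ fun j : Fin 2 => (![A₄, A₁₂] : Fin 2 → AbelianVariety ℂ) j] : Fin 2 → AbelianVariety ℂ) i ⟶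
        (![⨁ fun j : Fin 2 => (![A₃, A₆] : Fin 2 → AbelianVariety ℂ) j,
          ⨁ fun j : Fin 2 => (![A₄, A₁₂] : Fin 2 → AbelianVariety ℂ) j] : Fin 2 → AbelianVariety ℂ) j, f = 0 := by
  haveI : NeZero (3 : ℕ) := ⟨by norm_num⟩
  haveI : NeZero (2 * 3 : ℕ) := ⟨by norm_num⟩
  haveI : NeZero (12 : ℕ) := ⟨by norm_num⟩
  have hodd : Odd 3 := by decide
  -- the four elementary relations (F12)
  have o34 := orthogonal_odd_four (Φ' := Φ₄) hodd le_rfl hΦ₃ hA₃ hA₄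
  have o64 := orthogonal_twiceOdd_four (Φ' := Φ₄) hodd le_rfl hΨ hA₆ hA₄
  have o312 := orthogonal_odd_fourDvd hodd le_rfl hΦ₃ hA₃ ⟨3, rfl⟩ (by norm_num) (by norm_num) (by norm_num) (by norm_num) hΦ₁₂ hA₁₂
  have o612 := orthogonal_twiceOdd_fourDvd hodd le_rfl hΨ hA₆ ⟨3, rfl⟩ (by norm_num) (by norm_num) (by norm_num) (by norm_num) hΦ₁₂ hA₁₂
  -- a homomorphism between two `Fin 2`-biproducts vanishes if its four components do
  have hblock : ∀ {P Q R S : AbelianVariety ℂ}, (∀ u : P ⟶ R, u = 0) → (∀ u : P ⟶ S, u = 0) → (∀ u : Q ⟶ R, u = 0) →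
      (∀ u : Q ⟶ S, u = 0) →
      ∀ f : (⨁ fun j : Fin 2 => (![P, Q] : Fin 2 → AbelianVariety ℂ) j) ⟶
        ⨁ fun j : Fin 2 => (![R, S] : Fin 2 → AbelianVariety ℂ) j, f = 0 := by
    intro P Q R S hPR hPS hQR hQS f
    refine biproduct.hom_ext _ _ fun l => biproduct.hom_ext' _ _ fun k => ?_
    rw [zero_comp, comp_zero]
    match k, l with
    | ⟨0, _⟩, ⟨0, _⟩ => exact hPR _
    | ⟨0, _⟩, ⟨1, _⟩ => exact hPS _
    | ⟨1, _⟩, ⟨0, _⟩ => exact hQR _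
    | ⟨1, _⟩, ⟨1, _⟩ => exact hQS _
  intro i j hij f
  match i, j with
  | ⟨0, _⟩, ⟨0, _⟩ => exact absurd rfl hij
  | ⟨1, _⟩, ⟨1, _⟩ => exact absurd rfl hij
  | ⟨0, _⟩, ⟨1, _⟩ => exact hblock o34.1 o312.1 o64.1 o612.1 f
  | ⟨1, _⟩, ⟨0, _⟩ => exact hblock o34.2.1 o64.2.1 o312.2.1 o612.2.1 f

/-! ## §3 `End⁰(J_{12}) ≅ Mat₂(ℚ(ζ_3)) × Mat₃(ℚ(ζ_4))`, `dim_ℚ = 26`, `dim J_{12} = 5` -/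

/-- **GGL THM. 3.0 + LEMMA 14 at `m = 12`, with `Y_{12} = X_4`: `End⁰(J_{12}) ≃ₐ[ℚ] Mat₂(ℚ(ζ_3)) × Mat₃(ℚ(ζ_4))`** on the carrier
`⨁_{Fin 2} ![A₃ ⊕ A₆, A₄ ⊕ A₁₂]` — the two blocks are orthogonal (§2), `End⁰` of an orthogonal biproduct is the product (Mumford §19 Cor. 2,
tree `AbelianVariety.nonempty_algEquiv_endAlgebra_biproduct_pi`), and the blocks have `End⁰ ≅ Mat₂(ℚ(ζ_3))`, `Mat₃(ℚ(ζ_4))`.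
[cite: GalleseGoodsonLombardo2024, §3.5 Lemma 14 and the sentence following it; §3 Thm. 3.0 (4), (5), last statement]
[cite: MumfordAV1970, §19 Cor. 2 of Thm. 3 and p. 174] [cite: Shimura1998, §5.1 Prop. 3 (proof) and Prop. 6] -/
theorem nonempty_endAlgebra_algEquiv_twelveJacobian (hΦ₃ : ∀ σ : K₃ →+* ℂ, σ ∈ Φ₃.1 ↔ 2 * (expOf 3 K₃ σ).val < 3)
    (hA₃ : IsCMTypeRealisation Φ₃ A₃ ι₃ θ₃)
    (hΨ : ∀ σ : L →+* ℂ, σ ∈ Ψ.1 ↔ 2 * (expOf (2 * 3) L σ).val < 2 * 3) (hA₆ : IsCMTypeRealisation Ψ A₆ ι₆ θ₆)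
    (hΦ₄ : ∀ σ : K₄ →+* ℂ, σ ∈ Φ₄.1 ↔ 2 * (expOf 4 K₄ σ).val < 4) (hA₄ : IsCMTypeRealisation Φ₄ A₄ ι₄ θ₄)
    (hΦ₁₂ : ∀ σ : K₁₂ →+* ℂ, σ ∈ Φ₁₂.1 ↔ 2 * (expOf 12 K₁₂ σ).val < 12) (hA₁₂ : IsCMTypeRealisation Φ₁₂ A₁₂ ι₁₂ θ₁₂) :
    Nonempty ((⨁ fun i : Fin 2 =>
        (![⨁ fun j : Fin 2 => (![A₃, A₆] : Fin 2 → AbelianVariety ℂ) j,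
           ⨁ fun j : Fin 2 => (![A₄, A₁₂] : Fin 2 → AbelianVariety ℂ) j] : Fin 2 → AbelianVariety ℂ) i).endAlgebra ≃ₐ[ℚ]
      Matrix (Fin 2) (Fin 2) K₃ × Matrix (Fin 3) (Fin 3) K₄) := by
  classical
  obtain ⟨E, -⟩ := AbelianVariety.nonempty_algEquiv_endAlgebra_biproduct_pi
    (A := fun i : Fin 2 => (![⨁ fun j : Fin 2 => (![A₃, A₆] : Fin 2 → AbelianVariety ℂ) j,
      ⨁ fun j : Fin 2 => (![A₄, A₁₂] : Fin 2 → AbelianVariety ℂ) j] : Fin 2 → AbelianVariety ℂ) i)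
    (hom_eq_zero_blocks_twelve hΦ₃ hA₃ hΨ hA₆ hA₄ hΦ₁₂ hA₁₂)
  obtain ⟨P⟩ := nonempty_pi_fin_two_algEquiv_prod
    (fun i : Fin 2 => ((![⨁ fun j : Fin 2 => (![A₃, A₆] : Fin 2 → AbelianVariety ℂ) j,
      ⨁ fun j : Fin 2 => (![A₄, A₁₂] : Fin 2 → AbelianVariety ℂ) j] : Fin 2 → AbelianVariety ℂ) i).endAlgebra)
  obtain ⟨e₀⟩ := nonempty_endAlgebra_three_six_algEquiv_matrix hΦ₃ hA₃ hΨ hA₆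
  obtain ⟨e₁⟩ := nonempty_endAlgebra_four_twelve_algEquiv_matrix hΦ₄ hA₄ hΦ₁₂ hA₁₂
  exact ⟨(E.trans P).trans (AlgEquiv.prodCongr e₀ e₁)⟩

omit [IsCyclotomicExtension {4} ℚ K₄] in
/-- `[ℚ(ζ_4) : ℚ] = 2`. [folklore] -/
private theorem finrank_eq_two_of_four' [IsCyclotomicExtension {4} ℚ K₄] : finrank ℚ K₄ = 2 := by
  haveI : NeZero (4 : ℕ) := ⟨by norm_num⟩
  rw [IsCyclotomicExtension.finrank (K := ℚ) (n := 4) K₄ (Polynomial.cyclotomic.irreducible_rat (by norm_num))]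
  decide +kernel

omit [IsCyclotomicExtension {3} ℚ K₃] in
/-- `[ℚ(ζ_3) : ℚ] = 2`. [folklore] -/
private theorem finrank_eq_two_of_three [IsCyclotomicExtension {3} ℚ K₃] : finrank ℚ K₃ = 2 := by
  haveI : NeZero (3 : ℕ) := ⟨by norm_num⟩
  rw [IsCyclotomicExtension.finrank (K := ℚ) (n := 3) K₃ (Polynomial.cyclotomic.irreducible_rat (by norm_num))]
  decide +kernel

/-- **`dim_ℚ End⁰(J_{12}) = 26` and `dim J_{12} = 5 = g(C_{12})`** (`8 + 18`; `(1 + 1) + (1 + 2)`). [cite: GalleseGoodsonLombardo2024, §3 Thm. 3.0 and §3.5 Lemma 14]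
[cite: MumfordAV1970, §19 Cor. 2 of Thm. 3] -/
theorem finrank_endAlgebra_twelveJacobian (hΦ₃ : ∀ σ : K₃ →+* ℂ, σ ∈ Φ₃.1 ↔ 2 * (expOf 3 K₃ σ).val < 3)
    (hA₃ : IsCMTypeRealisation Φ₃ A₃ ι₃ θ₃)
    (hΨ : ∀ σ : L →+* ℂ, σ ∈ Ψ.1 ↔ 2 * (expOf (2 * 3) L σ).val < 2 * 3) (hA₆ : IsCMTypeRealisation Ψ A₆ ι₆ θ₆)
    (hΦ₄ : ∀ σ : K₄ →+* ℂ, σ ∈ Φ₄.1 ↔ 2 * (expOf 4 K₄ σ).val < 4) (hA₄ : IsCMTypeRealisation Φ₄ A₄ ι₄ θ₄)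
    (hΦ₁₂ : ∀ σ : K₁₂ →+* ℂ, σ ∈ Φ₁₂.1 ↔ 2 * (expOf 12 K₁₂ σ).val < 12) (hA₁₂ : IsCMTypeRealisation Φ₁₂ A₁₂ ι₁₂ θ₁₂) :
    finrank ℚ (⨁ fun i : Fin 2 =>
        (![⨁ fun j : Fin 2 => (![A₃, A₆] : Fin 2 → AbelianVariety ℂ) j,
           ⨁ fun j : Fin 2 => (![A₄, A₁₂] : Fin 2 → AbelianVariety ℂ) j] : Fin 2 → AbelianVariety ℂ) i).endAlgebra = 26 ∧
    (⨁ fun i : Fin 2 =>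
        (![⨁ fun j : Fin 2 => (![A₃, A₆] : Fin 2 → AbelianVariety ℂ) j,
           ⨁ fun j : Fin 2 => (![A₄, A₁₂] : Fin 2 → AbelianVariety ℂ) j] : Fin 2 → AbelianVariety ℂ) i).dim = 5 := by
  classical
  haveI : NeZero (3 : ℕ) := ⟨by norm_num⟩
  haveI : NeZero (2 * 3 : ℕ) := ⟨by norm_num⟩
  haveI : NeZero (12 : ℕ) := ⟨by norm_num⟩
  refine ⟨?_, ?_⟩
  · obtain ⟨e⟩ := nonempty_endAlgebra_algEquiv_twelveJacobian hΦ₃ hA₃ hΨ hA₆ hΦ₄ hA₄ hΦ₁₂ hA₁₂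
    haveI : Module.Finite ℚ (Matrix (Fin 2) (Fin 2) K₃) := Module.Finite.matrix
    haveI : Module.Finite ℚ (Matrix (Fin 3) (Fin 3) K₄) := Module.Finite.matrix
    rw [e.toLinearEquiv.finrank_eq, Module.finrank_prod, Module.finrank_matrix, Module.finrank_matrix, Fintype.card_fin,
      Fintype.card_fin, finrank_eq_two_of_three (K₃ := K₃), finrank_eq_two_of_four' (K₄ := K₄)]
  · have hd₃ : A₃.dim = 1 := by
      have h : A₃.dim = finrank ℚ K₃ / 2 := Motives.schemeDim_eq_holds hA₃.1
      rw [finrank_eq_two_of_three (K₃ := K₃)] at h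
      simpa using h
    have hd₆ : A₆.dim = 1 := by
      have h : A₆.dim = finrank ℚ L / 2 := Motives.schemeDim_eq_holds hA₆.1
      rw [IsCyclotomicExtension.finrank (K := ℚ) (n := 2 * 3) L (Polynomial.cyclotomic.irreducible_rat (by norm_num)),
        show Nat.totient (2 * 3) = 2 by decide +kernel] at h
      simpa using h
    have hd₄ : A₄.dim = 1 := by
      have h : A₄.dim = finrank ℚ K₄ / 2 := Motives.schemeDim_eq_holds hA₄.1
      rw [finrank_eq_two_of_four' (K₄ := K₄)] at h
      simpa using h
    have hd₁₂ : A₁₂.dim = 2 := by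
      have h : A₁₂.dim = finrank ℚ K₁₂ / 2 := Motives.schemeDim_eq_holds hA₁₂.1
      rw [IsCyclotomicExtension.finrank (K := ℚ) (n := 12) K₁₂ (Polynomial.cyclotomic.irreducible_rat (by norm_num)),
        show Nat.totient 12 = 4 by decide +kernel] at h
      simpa using h
    rw [AbelianVariety.dim_biproduct, Fin.sum_univ_two]
    simp only [Matrix.cons_val_zero, Matrix.cons_val_one]
    rw [AbelianVariety.dim_biproduct, AbelianVariety.dim_biproduct, Fin.sum_univ_two, Fin.sum_univ_two]
    simp only [Matrix.cons_val_zero, Matrix.cons_val_one]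
    omega

end Blocks

end HyperellipticJacobian

end Literature.AlgebraicGeometry.ComplexMultiplication

end
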